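import Summits.ResolutionOfSingularities.ResolutionOfSingularities.Theses.Dominance
import Summits.ResolutionOfSingularities.ResolutionOfSingularities.Theorems.MaxOrderAtomClasses
import Summits.ResolutionOfSingularities.ResolutionOfSingularities.Theorems.DominanceDivisorCut
import Summits.ResolutionOfSingularities.ResolutionOfSingularities.Theorems.RegularBlowupsDesingularization
import Summits.ResolutionOfSingularities.ResolutionOfSingularities.Theorems.DominanceOfTwoModelPatching
import Literature.AlgebraicGeometry.Morphisms.NagataCompactificationProofs
import Literature.AlgebraicGeometry.Resolution.BlowupsComposition
import Literature.AlgebraicGeometry.Resolution.BlowupsIntegral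
import Literature.AlgebraicGeometry.Resolution.BlowupsProduct
import Literature.AlgebraicGeometry.Resolution.BlowupsProperProofs
import Literature.AlgebraicGeometry.Resolution.ComponentGluing
import Literature.AlgebraicGeometry.Resolution.OrderSemicontinuity
import Literature.AlgebraicGeometry.Resolution.QuasiExcellentSchemes
import Literature.AlgebraicGeometry.Resolution.ExcellentRingsFieldProofs
import Literature.AlgebraicGeometry.Resolution.SandwichedWeakPatching
import HarnessLib

/-!
# DominanceMaxOrderAtoms — Part A/A′ kernels of the decomp-res node «MaxOrderAtoms» (lens-3 g7) BY NAME

Source HOME/decomp-res-lens-3/g7/MaxOrderAtoms.lean (sha256 91036a4fcfe2fdc9, 782 lines; critic `lean check` rc 0 ·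
0 err · 0 warn · 0 sorry · `closes_atoms` axioms standard), CRITIC-LEDGER row 46 (2026-08-30T07:24Z): CLEARED AS MAP +
PORT-SHARPENING NODE (residual 0 · decision 0 · map/port +1).  Pieces = asides of `Theses/Dominance.lean` (Part A,
refining MR^{proper} = `SandwichedResolveProper` 24574): `BlowupResolve`, `MaxOrderStepsTame` (∀ r ≥ 1, TAME atom:
ATTACKABLE-mod-port at the dim-4 rung only, glue modulo dimension d−1 above), `MaxOrderStepsWild` (∀ r ≥ 1, WILD atom:
IDEA-NEEDED, ⊇ everything hard, score 0 — VARIANT of OrderCut's order-vs-p cut in all-ideal rung format),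
`BlowupResolveDimFour` (the first open slice), over the notions of `Theorems.MaxOrderAtomClasses` (p764812).

Kernels (all PROVED, 0 sorry): the base rung `upTo_zero`; Cutkosky's induction on the maximal order
`blowupResolveLE_of_steps`; the ORDER BOUND from excellence `blowupResolve_of_steps`; Raynaud–Gruson domination
`sandwichedResolveProper_of_blowupResolve` (tree `exists_isBlowup_dominating`); EXACTNESS
`blowupResolve_iff_item24574`, `blowupResolve_iff_steps`, `item24574_iff_atoms` (24574 ⟺ Tame ∧ Wild), the dim-4
slice `blowupResolveDimFour_iff_atoms`; necessity `*_of_summit`; and the ROOT through `Dominance.closes` with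
`Dominance.ProperReduction` (29719) BY NAME (`closes_atoms`; `closes_atoms_nagata` via the landed
`DominanceDivisorCut.properReduction_of_nagata` — nothing re-proved).
Why this is novel (cell-relative): MR's dim-≥4 residual is re-typed as MAX-ORDER ATOMS in Cutkosky-5.1 format for ALL
ideals (not pencils), with the tame/wild cut by `r` vs `p`, and the translation is EXACT with no costume consumed.
[Cutkosky2009 Thm. 1.3/5.1; Wlodarczyk2005 §4; StacksProject 081T]
-/

namespace Summit.ResolutionOfSingularities.ResolutionOfSingularities.Theorems.DominanceMaxOrderAtoms

open CategoryTheory CategoryTheory.Limits AlgebraicGeometry TopologicalSpace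
open Literature.AlgebraicGeometry.Resolution Literature.AlgebraicGeometry.Morphisms
open Summit.ResolutionOfSingularities.ResolutionOfSingularities.Theses
open Summit.ResolutionOfSingularities.ResolutionOfSingularities.Theorems
open MaxOrderAtomClasses

/-! ## The ladder (Part A kernels) -/

/-- **BASE of the ladder, PROVED**: an ideal of order `≤ 0` everywhere is the unit ideal, whose blow-up is an
isomorphism onto the regular `Y`. [folklore] -/
theorem upTo_zero (k : Type) [Field k] : UpTo k 0 := by
  intro Y g hg₁ hg₂ hg₃ hY hYreg I hI hord Γ b hb
  have hsupp : (I.support : Set Y) = ∅ := by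
    refine Set.eq_empty_iff_forall_notMem.mpr fun y hy => ?_
    have h1 : (1 : ℕ∞) ≤ idealOrder I y := (one_le_idealOrder_iff I y).mpr hy
    have h2 : idealOrder I y ≤ ((0 : ℕ) : ℕ∞) := hord y
    have : (1 : ℕ∞) ≤ 0 := h1.trans (by simpa using h2)
    exact absurd this (by norm_num)
  have hI' : I = ⊤ := by
    rw [← Scheme.IdealSheafData.support_eq_bot_iff]
    exact TopologicalSpace.Closeds.ext (by rw [TopologicalSpace.Closeds.coe_bot]; exact hsupp)
  subst hI'
  haveI : IsIso b := hb.isIso isEffectiveCartier_top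
  exact ComponentGluing.Scheme.HasResolution.of_isBirational (inv b) (isBirational_of_isIso _)
    hYreg.hasResolution

/-- The base rung `m = 0` over every field. [folklore] -/
theorem blowupResolveLE_zero : BlowupResolveLE 0 := fun _ _ k _ _ => upTo_zero k

/-- **Cutkosky's induction on the maximal order, PROVED**: the atoms climb the ladder.
[cite: Cutkosky2009, Thm. 1.3] -/
theorem blowupResolveLE_of_steps (hS : ∀ r : ℕ, 1 ≤ r → MaxOrderStep r) : ∀ m : ℕ, BlowupResolveLE m := by
  intro m
  induction m with
  | zero => exact blowupResolveLE_zero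
  | succ m ih =>
    intro p hp k _ _
    have h := hS (m + 1) (Nat.succ_le_succ (Nat.zero_le m)) p hp k
    rw [Nat.add_sub_cancel] at h
    exact h (ih p hp k)

/-- **The ORDER BOUND, PROVED** (tree `exists_forall_idealOrder_lt` on the excellent regular integral variety `Y`):
all atoms together give `Dominance.BlowupResolve`. [folklore] -/
theorem blowupResolve_of_steps (hS : ∀ r : ℕ, 1 ≤ r → MaxOrderStep r) : Dominance.BlowupResolve := by
  intro p hp k _ _ Y g hg₁ hg₂ hg₃ hY hYreg I hI Γ b hb
  haveI := hg₁; haveI := hg₂; haveI := hg₃; haveI := hY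
  haveI : IsLocallyNoetherian Y := LocallyOfFiniteType.isLocallyNoetherian g
  haveI : CompactSpace Y := QuasiCompact.compactSpace_of_compactSpace g
  haveI : IsNoetherian Y := {}
  have hE : Scheme.IsExcellent Y := Scheme.isExcellent_of_locallyOfFiniteType Stacks07QW_field_holds g
  obtain ⟨N, hN⟩ := exists_forall_idealOrder_lt hYreg hE hI
  exact blowupResolveLE_of_steps hS N p hp k Y g hg₁ hg₂ hg₃ hY hYreg I hI
    (fun y => (hN y).le) Γ b hb

/-- The atoms from the two route asides. [folklore] -/
theorem steps_of_tame_of_wild (hT : Dominance.MaxOrderStepsTame) (hW : Dominance.MaxOrderStepsWild) :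
    ∀ r : ℕ, 1 ≤ r → MaxOrderStep r :=
  fun r hr => (maxOrderStep_iff r).mpr ⟨hT r hr, hW r hr⟩

/-- **MR (proper form, 24574 BY NAME) ⟸ `Dominance.BlowupResolve`, PROVED**: a proper birational `b : Γ → Y` onto a
regular integral variety is dominated by a blow-up `η : Bl_I Y → Y`, `I ≠ 0`, through a proper birational
`r : Bl_I Y → Γ` (Raynaud–Gruson, tree `exists_isBlowup_dominating`); resolutions descend along `r`.
[cite: StacksProject, Tag 081T] -/
theorem sandwichedResolveProper_of_blowupResolve (h : Dominance.BlowupResolve) :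
    Dominance.SandwichedResolveProper := by
  intro p hp k _ _ Y g hg₁ hg₂ hg₃ hY hYreg Γ b hΓ hb hbir
  haveI := hg₁; haveI := hg₂; haveI := hg₃; haveI := hY; haveI := hΓ; haveI := hb
  haveI : IsLocallyNoetherian Y := LocallyOfFiniteType.isLocallyNoetherian g
  haveI : CompactSpace Y := QuasiCompact.compactSpace_of_compactSpace g
  haveI : IsNoetherian Y := {}
  obtain ⟨U, hUd, hUd', hUiso⟩ := hbir
  haveI := hUiso
  have hUc : IsCompact (U : Set Y) := NoetherianSpace.isCompact _
  obtain ⟨I, S', η, r, -, hsupp, hη, hrb, hr⟩ := exists_isBlowup_dominating b U hUc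
  obtain ⟨y₀, hy₀⟩ := hUd.nonempty
  have hI : I ≠ ⊥ := by
    intro hI0
    have h1 : (I.support : Set Y) = Set.univ := by
      rw [hI0, Scheme.IdealSheafData.support_bot]; rfl
    have : y₀ ∈ (I.support : Set Y) := by rw [h1]; trivial
    rw [hsupp] at this
    exact this hy₀
  have hS' : Scheme.HasResolution S' := h p hp k Y g hg₁ hg₂ hg₃ hY hYreg I hI S' η hη
  haveI : IsProper η := hη.isProper
  haveI : IsProper (r ≫ b) := by rw [hrb]; infer_instance
  haveI : IsProper r := IsProper.of_comp r b
  have hIb : I.comap b ≠ ⊥ := by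
    intro h0
    have h1 : ((I.comap b).support : Set Γ) = Set.univ := by
      rw [h0, Scheme.IdealSheafData.support_bot]; rfl
    rw [Scheme.IdealSheafData.support_comap] at h1
    obtain ⟨x, hx⟩ := hUd'.nonempty
    have hmem : x ∈ (TopologicalSpace.Closeds.preimage I.support b.continuous : Set Γ) := by
      rw [h1]; trivial
    rw [TopologicalSpace.Closeds.coe_preimage, Set.mem_preimage, hsupp] at hmem
    exact hmem hx
  have hrbir : IsBirational r := hr.isBirational' hIb
  exact ComponentGluing.Scheme.HasResolution.of_isBirational r hrbir hS'

/-- MR^{proper} (24574 BY NAME) from the two atom asides. PROVED. [folklore] -/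
theorem sandwichedResolveProper_of_atoms (hT : Dominance.MaxOrderStepsTame) (hW : Dominance.MaxOrderStepsWild) :
    Dominance.SandwichedResolveProper :=
  sandwichedResolveProper_of_blowupResolve (blowupResolve_of_steps (steps_of_tame_of_wild hT hW))

/-! ## The ROOT through `Dominance.closes` BY NAME -/

/-- **closes_atoms**: RegularRoofs (24573) → ProperReduction (29719) → MaxOrderStepsTame → MaxOrderStepsWild → ROOT.
[folklore] -/
theorem closes_atoms (hR : Dominance.RegularRoofs) (hP : Dominance.ProperReduction)
    (hT : Dominance.MaxOrderStepsTame) (hW : Dominance.MaxOrderStepsWild) : _root_.ResolutionOfSingularities :=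
  Dominance.closes hR (hP (sandwichedResolveProper_of_atoms hT hW))

/-- The same with the Nagata step discharged by the tree's named fact (landed kernel
`DominanceDivisorCut.properReduction_of_nagata`). [cite: Conrad2007, Thm. 4.1] -/
theorem closes_atoms_nagata (hN : NagataCompactification.{0}) (hR : Dominance.RegularRoofs)
    (hT : Dominance.MaxOrderStepsTame) (hW : Dominance.MaxOrderStepsWild) : _root_.ResolutionOfSingularities :=
  closes_atoms hR (DominanceDivisorCut.properReduction_of_nagata hN) hT hW

/-! ## Necessity: no piece is stronger than the summit -/

/-- `MR^{proper} (24574) ⟹ Dominance.BlowupResolve` (a blow-up along `I ≠ 0` of an integral variety is proper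
birational with integral source). [folklore] -/
theorem blowupResolve_of_sandwichedResolveProper (h : Dominance.SandwichedResolveProper) :
    Dominance.BlowupResolve := by
  intro p hp k _ _ Y g hg₁ hg₂ hg₃ hY hYreg I hI Γ b hb
  haveI := hg₁; haveI := hg₂; haveI := hg₃; haveI := hY
  haveI : IsLocallyNoetherian Y := LocallyOfFiniteType.isLocallyNoetherian g
  exact h p hp k Y g hg₁ hg₂ hg₃ hY hYreg Γ b (hb.isIntegral hI) hb.isProper (hb.isBirational' hI)

/-- `S ⟹ Dominance.BlowupResolve` (a blow-up of an integral variety along `I ≠ 0` is an integral variety, proper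
over `Y`). [folklore] -/
theorem blowupResolve_of_summit (h : _root_.ResolutionOfSingularities) : Dominance.BlowupResolve := by
  intro p hp k _ _ Y g hg₁ hg₂ hg₃ hY hYreg I hI Γ b hb
  haveI := hg₁; haveI := hg₂; haveI := hg₃; haveI := hY
  haveI : IsLocallyNoetherian Y := LocallyOfFiniteType.isLocallyNoetherian g
  haveI : IsProper b := hb.isProper
  haveI : IsIntegral Γ := hb.isIntegral hI
  -- the ROOT resolves every reduced scheme separated of finite type over `k` (`ResolutionOfSingularities_iff`;
  -- landed by name as `MaxContactCutTauCut.hasResolution_of_summit`, inlined to keep this module's imports small)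
  exact _root_.ResolutionOfSingularities_iff.mp h p hp k Γ (b ≫ g) inferInstance inferInstance
    inferInstance inferInstance

/-- `MR (24572) ⟹ Dominance.BlowupResolve` (MR contains every blow-up). [folklore] -/
theorem blowupResolve_of_sandwichedResolve (h : Dominance.SandwichedResolve) : Dominance.BlowupResolve := by
  intro p hp k _ _ Y g hg₁ hg₂ hg₃ hY hYreg I hI Γ b hb
  haveI := hg₁; haveI := hg₂; haveI := hg₃; haveI := hY
  haveI : IsLocallyNoetherian Y := LocallyOfFiniteType.isLocallyNoetherian g
  haveI : IsProper b := hb.isProper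
  haveI : IsIntegral Γ := hb.isIntegral hI
  exact h p hp k Y g hg₁ hg₂ hg₃ hYreg Γ b inferInstance inferInstance inferInstance (hb.isBirational' hI)
    inferInstance

/-- `BlowupResolve ⟹ MaxOrderStep r` (the conclusion of the atom is a slice). [folklore] -/
theorem maxOrderStep_of_blowupResolve (h : Dominance.BlowupResolve) (r : ℕ) : MaxOrderStep r :=
  fun p hp k _ _ _ Y g hg₁ hg₂ hg₃ hY hYreg I hI _ Γ b hb => h p hp k Y g hg₁ hg₂ hg₃ hY hYreg I hI Γ b hb

/-- `S ⟹ MaxOrderStepsTame`. [folklore] -/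
theorem maxOrderStepsTame_of_summit (h : _root_.ResolutionOfSingularities) : Dominance.MaxOrderStepsTame :=
  fun r _ => ((maxOrderStep_iff r).mp (maxOrderStep_of_blowupResolve (blowupResolve_of_summit h) r)).1

/-- `S ⟹ MaxOrderStepsWild`. [folklore] -/
theorem maxOrderStepsWild_of_summit (h : _root_.ResolutionOfSingularities) : Dominance.MaxOrderStepsWild :=
  fun r _ => ((maxOrderStep_iff r).mp (maxOrderStep_of_blowupResolve (blowupResolve_of_summit h) r)).2

/-! ## EXACTNESS certificates of the translation (Part A′) -/

/-- **EXACT: `Dominance.BlowupResolve ⟺ Dominance.SandwichedResolveProper` (24574).** PROVED. [folklore] -/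
theorem blowupResolve_iff_item24574 : Dominance.BlowupResolve ↔ Dominance.SandwichedResolveProper :=
  ⟨sandwichedResolveProper_of_blowupResolve, blowupResolve_of_sandwichedResolveProper⟩

/-- **EXACT: `Dominance.BlowupResolve ⟺ ∀ r ≥ 1, MaxOrderStep r`** (Cutkosky's induction is lossless). [folklore] -/
theorem blowupResolve_iff_steps : Dominance.BlowupResolve ↔ ∀ r : ℕ, 1 ≤ r → MaxOrderStep r :=
  ⟨fun h r _ => maxOrderStep_of_blowupResolve h r, fun h => blowupResolve_of_steps h⟩

/-- **EXACT: MR^{proper} (24574) ⟺ MaxOrderStepsTame ∧ MaxOrderStepsWild.** PROVED. [folklore] -/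
theorem item24574_iff_atoms :
    Dominance.SandwichedResolveProper ↔ Dominance.MaxOrderStepsTame ∧ Dominance.MaxOrderStepsWild :=
  ⟨fun h =>
    ⟨fun r _ => ((maxOrderStep_iff r).mp (maxOrderStep_of_blowupResolve
        (blowupResolve_of_sandwichedResolveProper h) r)).1,
      fun r _ => ((maxOrderStep_iff r).mp (maxOrderStep_of_blowupResolve
        (blowupResolve_of_sandwichedResolveProper h) r)).2⟩,
    fun h => sandwichedResolveProper_of_atoms h.1 h.2⟩

/-! ## The FIRST OPEN SLICE (dimension 4): `Dominance.BlowupResolveDimFour` and its atoms -/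

/-- The dim-4 ladder climbs: base (`upTo_zero`) + tame + wild dim-4 atoms ⇒ every rung. [folklore] -/
theorem upToDimFour_of_atoms {p : ℕ} (hp : p.Prime) (k : Type) [Field k] [CharP k p]
    (hT : ∀ r : ℕ, 1 ≤ r → MaxOrderStepTameDimFour r) (hW : ∀ r : ℕ, 1 ≤ r → MaxOrderStepWildDimFour r) :
    ∀ m : ℕ, UpToDimFour k m := by
  intro m
  induction m with
  | zero => exact upToDimFour_of_upTo (upTo_zero k)
  | succ m ih =>
    have hm : 1 ≤ m + 1 := Nat.succ_le_succ (Nat.zero_le m)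
    rcases Nat.lt_or_ge (m + 1) p with h | h
    · have := hT (m + 1) hm p hp k h
      rw [Nat.add_sub_cancel] at this
      exact this ih
    · have := hW (m + 1) hm p hp k h
      rw [Nat.add_sub_cancel] at this
      exact this ih

/-- **The first open slice from its atoms, PROVED** (order bound from excellence). [folklore] -/
theorem blowupResolveDimFour_of_atoms (hT : ∀ r : ℕ, 1 ≤ r → MaxOrderStepTameDimFour r)
    (hW : ∀ r : ℕ, 1 ≤ r → MaxOrderStepWildDimFour r) : Dominance.BlowupResolveDimFour := by
  intro p hp k _ _ Y g hg₁ hg₂ hg₃ hY hYreg hY4 I hI Γ b hb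
  haveI := hg₁; haveI := hg₂; haveI := hg₃; haveI := hY
  haveI : IsLocallyNoetherian Y := LocallyOfFiniteType.isLocallyNoetherian g
  haveI : CompactSpace Y := QuasiCompact.compactSpace_of_compactSpace g
  haveI : IsNoetherian Y := {}
  have hE : Scheme.IsExcellent Y := Scheme.isExcellent_of_locallyOfFiniteType Stacks07QW_field_holds g
  obtain ⟨N, hN⟩ := exists_forall_idealOrder_lt hYreg hE hI
  exact upToDimFour_of_atoms hp k hT hW N Y g hg₁ hg₂ hg₃ hY hYreg hY4 I hI (fun y => (hN y).le) Γ b hb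

/-- Conversely the slice gives back every dim-4 atom (EXACT). [folklore] -/
theorem atomsDimFour_of_blowupResolveDimFour (h : Dominance.BlowupResolveDimFour) :
    (∀ r : ℕ, 1 ≤ r → MaxOrderStepTameDimFour r) ∧ (∀ r : ℕ, 1 ≤ r → MaxOrderStepWildDimFour r) :=
  ⟨fun _ _ p hp k _ _ _ _ Y g hg₁ hg₂ hg₃ hY hYreg hY4 I hI _ Γ b hb =>
      h p hp k Y g hg₁ hg₂ hg₃ hY hYreg hY4 I hI Γ b hb,
    fun _ _ p hp k _ _ _ _ Y g hg₁ hg₂ hg₃ hY hYreg hY4 I hI _ Γ b hb =>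
      h p hp k Y g hg₁ hg₂ hg₃ hY hYreg hY4 I hI Γ b hb⟩

/-- **EXACT: `Dominance.BlowupResolveDimFour ⟺ (∀ r ≥ 1, Tame₄ r) ∧ (∀ r ≥ 1, Wild₄ r)`.** PROVED. [folklore] -/
theorem blowupResolveDimFour_iff_atoms : Dominance.BlowupResolveDimFour ↔
    (∀ r : ℕ, 1 ≤ r → MaxOrderStepTameDimFour r) ∧ (∀ r : ℕ, 1 ≤ r → MaxOrderStepWildDimFour r) :=
  ⟨atomsDimFour_of_blowupResolveDimFour, fun h => blowupResolveDimFour_of_atoms h.1 h.2⟩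

/-- Restriction: the all-dimensional statement contains the dim-4 slice. [folklore] -/
theorem blowupResolveDimFour_of_blowupResolve (h : Dominance.BlowupResolve) : Dominance.BlowupResolveDimFour :=
  fun p hp k _ _ Y g hg₁ hg₂ hg₃ hY hYreg _ I hI Γ b hb => h p hp k Y g hg₁ hg₂ hg₃ hY hYreg I hI Γ b hb

/-- `S ⟹ Dominance.BlowupResolveDimFour`. [folklore] -/
theorem blowupResolveDimFour_of_summit (h : _root_.ResolutionOfSingularities) : Dominance.BlowupResolveDimFour :=
  blowupResolveDimFour_of_blowupResolve (blowupResolve_of_summit h)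

/-- `S ⟹` the located residual `MaxOrderStepWildDimFour r` (not stronger than the summit). [folklore] -/
theorem maxOrderStepWildDimFour_of_summit (h : _root_.ResolutionOfSingularities) (r : ℕ) (hr : 1 ≤ r) :
    MaxOrderStepWildDimFour r :=
  (atomsDimFour_of_blowupResolveDimFour (blowupResolveDimFour_of_summit h)).2 r hr

/-- `S ⟹ MaxOrderStepTameDimFour r`. [folklore] -/
theorem maxOrderStepTameDimFour_of_summit (h : _root_.ResolutionOfSingularities) (r : ℕ) (hr : 1 ≤ r) :
    MaxOrderStepTameDimFour r :=
  (atomsDimFour_of_blowupResolveDimFour (blowupResolveDimFour_of_summit h)).1 r hr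

/-- All four Part-A pieces are summit-implied. [folklore] -/
theorem pieces_of_summit (h : _root_.ResolutionOfSingularities) :
    Dominance.BlowupResolve ∧ Dominance.MaxOrderStepsTame ∧ Dominance.MaxOrderStepsWild ∧
      Dominance.BlowupResolveDimFour :=
  ⟨blowupResolve_of_summit h, maxOrderStepsTame_of_summit h, maxOrderStepsWild_of_summit h,
    blowupResolveDimFour_of_summit h⟩

end Summit.ResolutionOfSingularities.ResolutionOfSingularities.Theorems.DominanceMaxOrderAtoms
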